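import Summits.Ventures.PercRepro.C025ProfileGirthRowSucc

/-!
# THE ROW `(q, q+1)` AT GIRTH `≥ q + 1`, EVERY RANK — PART A: THE PER-SET BOUND, THE TRANSFER, THE DOUBLE COUNT (night-3 g18)

Preparation for `C025ProfileGirthRowSuccAll` (the theorem): when every `q`-subset is independent and `ρ(E) ≥ q + 2`, a rank-`q`
set `B` with `k ≥ q + 1` points, `N_B = |E ∩ cl B|` and `m_B = |E ∖ cl B| ≥ 2` has price `≤ (min(q, N_B − k) + m_B)/(q + 1)`
(`price_succ_le_pbar`), and `price(B) + [k = q+1] − m_B ≤ e(B)` (`excess_le`) with the transfer term `e(B) = 1/(q+1)` on the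
`(q+1)`-subsets of the rank-`q` flats with `m = 2` and `N ≥ 2q + 1`, `e(B) = −q/(q+1)` on their `(q+2)`-subsets, `0` otherwise;
the double count `card_cond_le_mul_card_cond'` shows `#{(q+1)-subsets} ≤ q · #{(q+2)-subsets}` over those flats (each `(q+1)`-subset
has `N − q − 1 ≥ q` supersets `C ∪ {z}` inside the flat, each `(q+2)`-subset has `q + 2 ≤ q²` such subsets), so the transfer sums to
`≤ 0`.  No `def`, no `instance`, no notation.  Axioms: standard.
-/

open scoped Matroid

namespace PercRepro

open Set Finset ThmH Staged

namespace GirthRows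

variable {α : Type} [DecidableEq α] {M : Matroid α} [M.Finite]

open scoped Classical

/-- `ρ(E ∖ B) ≤ |F_B ∖ B| + m_B` where `F_B = E ∩ cl(B)` and `m_B = #(E ∖ cl B)`. -/
theorem eRk_sdiff_le_of_closure (B : Finset α) (hBg : B ⊆ gr M) :
    M.eRk ((gr M \ B : Finset α) : Set α) ≤
      ((((gr M).filter (fun x => x ∈ M.closure (B : Set α))).card - B.card +
        ((gr M).filter (fun x => x ∉ M.closure (B : Set α))).card : ℕ) : ℕ∞) := by
  set F := (gr M).filter (fun x => x ∈ M.closure (B : Set α)) with hF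
  set O := (gr M).filter (fun x => x ∉ M.closure (B : Set α)) with hO
  have hBF : B ⊆ F := by
    intro x hx
    rw [hF, Finset.mem_filter]
    have hBE : (B : Set α) ⊆ M.E := by rw [← coe_gr]; exact_mod_cast hBg
    exact ⟨hBg hx, M.subset_closure (B : Set α) hBE (Finset.mem_coe.2 hx)⟩
  have hsub : ((gr M \ B : Finset α) : Set α) ⊆ ((F \ B : Finset α) : Set α) ∪ (O : Set α) := by
    intro x hx
    rw [Finset.coe_sdiff, Set.mem_sdiff, Finset.mem_coe, Finset.mem_coe] at hx
    by_cases hc : x ∈ M.closure (B : Set α)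
    · left
      rw [Finset.coe_sdiff, Set.mem_sdiff, Finset.mem_coe, Finset.mem_coe, hF, Finset.mem_filter]
      exact ⟨⟨hx.1, hc⟩, hx.2⟩
    · right
      rw [Finset.mem_coe, hO, Finset.mem_filter]
      exact ⟨hx.1, hc⟩
  calc M.eRk ((gr M \ B : Finset α) : Set α)
      ≤ M.eRk (((F \ B : Finset α) : Set α) ∪ (O : Set α)) := M.eRk_mono hsub
    _ ≤ M.eRk ((F \ B : Finset α) : Set α) + M.eRk (O : Set α) := M.eRk_union_le_eRk_add_eRk _ _
    _ ≤ (((F \ B).card : ℕ) : ℕ∞) + ((O.card : ℕ) : ℕ∞) := by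
        gcongr
        · rw [← Set.encard_coe_eq_coe_finsetCard]; exact M.eRk_le_encard _
        · rw [← Set.encard_coe_eq_coe_finsetCard]; exact M.eRk_le_encard _
    _ = ((F.card - B.card + O.card : ℕ) : ℕ∞) := by
        rw [Finset.card_sdiff_of_subset hBF]
        push_cast
        rfl

/-- `ρ(E ∖ B) ≤ q + m_B` for a rank-`q` set (`eRk_sdiff_le_add_card_out` in `ℕ∞` with the rank substituted). -/
theorem eRk_sdiff_le_add_card_out' {q : ℕ} (B : Finset α) (hBr : M.eRk (B : Set α) = (q : ℕ∞)) :
    M.eRk ((gr M \ B : Finset α) : Set α) ≤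
      ((q + ((gr M).filter (fun x => x ∉ M.closure (B : Set α))).card : ℕ) : ℕ∞) := by
  have h := eRk_sdiff_le_add_card_out (M := M) B
  rw [hBr] at h
  rw [Nat.cast_add]
  exact h

/-- **The price bound**: for a rank-`q` set `B` of `k` points with `N_B = |E ∩ cl B|` and `m_B = |E ∖ cl B|`,
`price(B) ≤ (min(q, N_B − k) + m_B)/(q + 1)` at the level `q + 1`. -/
theorem price_succ_le_pbar {q : ℕ} {B : Finset α} (hB : B ∈ Profile.Rq M q) :
    Profile.price M q (q + 1) B ≤
      ((min q (((gr M).filter (fun x => x ∈ M.closure (B : Set α))).card - B.card) +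
        ((gr M).filter (fun x => x ∉ M.closure (B : Set α))).card : ℕ) : ℚ) / ((q : ℚ) + 1) := by
  obtain ⟨hBg, hBr⟩ := Profile.mem_Rq.1 hB
  have h1 := eRk_sdiff_le_of_closure (M := M) B hBg
  have h2 := eRk_sdiff_le_add_card_out' (M := M) B hBr
  unfold Profile.price
  split_ifs with hu
  · set p' := (M.eRk ((gr M \ B : Finset α) : Set α)).toNat with hp'
    have hfin : M.eRk ((gr M \ B : Finset α) : Set α) ≠ ⊤ := by
      have := M.eRk_le_encard ((gr M \ B : Finset α) : Set α)
      rw [Set.encard_coe_eq_coe_finsetCard] at this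
      exact ne_top_of_le_ne_top (ENat.coe_ne_top _) this
    have h1' : p' ≤ ((gr M).filter (fun x => x ∈ M.closure (B : Set α))).card - B.card +
        ((gr M).filter (fun x => x ∉ M.closure (B : Set α))).card := by
      rw [← ENat.coe_toNat hfin] at h1
      exact_mod_cast h1
    have h2' : p' ≤ q + ((gr M).filter (fun x => x ∉ M.closure (B : Set α))).card := by
      rw [← ENat.coe_toNat hfin] at h2
      exact_mod_cast h2
    have hpbar : p' ≤ min q (((gr M).filter (fun x => x ∈ M.closure (B : Set α))).card - B.card) +
        ((gr M).filter (fun x => x ∉ M.closure (B : Set α))).card := by omega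
    have hup' : q + 1 ≤ p' := by
      rw [← ENat.coe_toNat hfin] at hu
      exact_mod_cast hu
    rw [ThinGirth.choose_succ_div_choose (p' + q) q (by omega)]
    have hsub : p' + q - q = p' := by omega
    rw [hsub]
    have hden : ((q + 1 : ℕ) : ℚ) = (q : ℚ) + 1 := by push_cast; ring
    rw [hden]
    gcongr
  · apply div_nonneg <;> positivity

omit [DecidableEq α] in
/-- If `ρ(E) ≥ q + 2` then every rank-`q` set has at least two points of the ground set outside its closure. -/
theorem two_le_card_out {q : ℕ} (hrank : ((q + 2 : ℕ) : ℕ∞) ≤ M.eRank) {B : Finset α}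
    (hB : M.eRk (B : Set α) = (q : ℕ∞)) :
    2 ≤ ((gr M).filter (fun x => x ∉ M.closure (B : Set α))).card := by
  have hsub : M.E ⊆ M.closure (B : Set α) ∪
      (((gr M).filter (fun x => x ∉ M.closure (B : Set α)) : Finset α) : Set α) := by
    intro x hx
    by_cases hc : x ∈ M.closure (B : Set α)
    · exact Or.inl hc
    · right
      rw [Finset.mem_coe, Finset.mem_filter]
      exact ⟨ThinGirth.mem_gr_of_mem_ground hx, hc⟩
  have h1 : M.eRank ≤ (q : ℕ∞) + (((gr M).filter (fun x => x ∉ M.closure (B : Set α))).card : ℕ∞) := by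
    calc M.eRank = M.eRk M.E := Matroid.eRank_def M
      _ ≤ M.eRk (M.closure (B : Set α) ∪
            (((gr M).filter (fun x => x ∉ M.closure (B : Set α)) : Finset α) : Set α)) := M.eRk_mono hsub
      _ ≤ M.eRk (M.closure (B : Set α)) +
            M.eRk ((((gr M).filter (fun x => x ∉ M.closure (B : Set α)) : Finset α) : Set α)) :=
          M.eRk_union_le_eRk_add_eRk _ _
      _ ≤ (q : ℕ∞) + (((gr M).filter (fun x => x ∉ M.closure (B : Set α))).card : ℕ∞) := by
          rw [M.eRk_closure_eq, hB]
          gcongr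
          rw [← Set.encard_coe_eq_coe_finsetCard]
          exact M.eRk_le_encard _
  have h2 := hrank.trans h1
  have h3 : q + 2 ≤ q + ((gr M).filter (fun x => x ∉ M.closure (B : Set α))).card := by exact_mod_cast h2
  omega

omit [DecidableEq α] in
/-- `B ⊆ F_B` and hence `|B| ≤ N_B`. -/
theorem card_le_card_closureF {B : Finset α} (hBg : B ⊆ gr M) :
    B.card ≤ ((gr M).filter (fun x => x ∈ M.closure (B : Set α))).card := by
  apply Finset.card_le_card
  intro x hx
  rw [Finset.mem_filter]
  have hBE : (B : Set α) ⊆ M.E := by rw [← coe_gr]; exact_mod_cast hBg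
  exact ⟨hBg hx, M.subset_closure (B : Set α) hBE (Finset.mem_coe.2 hx)⟩

/-- **The per-set bound with the transfer term**: for a rank-`q` set `B` with `k ≥ q + 1` points, `m_B ≥ 2` and
`q ≥ 2`, `price(B) + [k = q+1] − m_B ≤ e(B)`, where `e(B) = 1/(q+1)` if `k = q + 1`, `m_B = 2`, `N_B ≥ 2q + 1`;
`e(B) = −q/(q+1)` if `k = q + 2`, `m_B = 2`, `N_B ≥ 2q + 1`; `e(B) = 0` otherwise. -/
theorem excess_le {q : ℕ} (hq : 2 ≤ q) {B : Finset α} (hB : B ∈ Profile.Rq M q) (hk : q + 1 ≤ B.card)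
    (hm : 2 ≤ ((gr M).filter (fun x => x ∉ M.closure (B : Set α))).card) :
    Profile.price M q (q + 1) B + (if B.card = q + 1 then (1 : ℚ) else 0) -
        (((gr M).filter (fun x => x ∉ M.closure (B : Set α))).card : ℚ) ≤
      (if B.card = q + 1 ∧ ((gr M).filter (fun x => x ∉ M.closure (B : Set α))).card = 2 ∧
          2 * q + 1 ≤ ((gr M).filter (fun x => x ∈ M.closure (B : Set α))).card then (1 : ℚ) / ((q : ℚ) + 1)
        else 0) +
      (if B.card = q + 2 ∧ ((gr M).filter (fun x => x ∉ M.closure (B : Set α))).card = 2 ∧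
          2 * q + 1 ≤ ((gr M).filter (fun x => x ∈ M.closure (B : Set α))).card then -(q : ℚ) / ((q : ℚ) + 1)
        else 0) := by
  have hpr := price_succ_le_pbar hB
  have hkN := card_le_card_closureF (Profile.mem_Rq.1 hB).1
  set N := ((gr M).filter (fun x => x ∈ M.closure (B : Set α))).card with hN
  set m := ((gr M).filter (fun x => x ∉ M.closure (B : Set α))).card with hm'
  set k := B.card with hk'
  have hq' : (2 : ℚ) ≤ q := by exact_mod_cast hq
  have hpos : (0 : ℚ) < (q : ℚ) + 1 := by positivity
  -- the price bound in ℚ with the minimum unfolded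
  have hpb : Profile.price M q (q + 1) B * ((q : ℚ) + 1) ≤ ((min q (N - k) + m : ℕ) : ℚ) := by
    rw [div_eq_mul_inv] at hpr
    have := mul_le_mul_of_nonneg_right hpr hpos.le
    rwa [mul_assoc, inv_mul_cancel₀ hpos.ne', mul_one] at this
  have hpnn : (0 : ℚ) ≤ Profile.price M q (q + 1) B := Profile.price_nonneg q (q + 1) B
  set P := Profile.price M q (q + 1) B with hP
  have hmq : (3 : ℚ) * q ≤ (m : ℚ) * q ∨ (m : ℚ) = 2 := by
    rcases Nat.lt_or_ge 2 m with h3 | h2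
    · left
      have : (3 : ℚ) ≤ m := by exact_mod_cast h3
      exact mul_le_mul_of_nonneg_right this (by positivity)
    · right
      have : m = 2 := by omega
      exact_mod_cast this
  rcases hmq with hm3 | hm2q
  · -- m ≥ 3: no transfer, (q + m)/(q+1) + 1 ≤ m
    have hne : ¬ m = 2 := by
      intro h
      have : (m : ℚ) = 2 := by exact_mod_cast h
      nlinarith
    have hb : ((min q (N - k) + m : ℕ) : ℚ) ≤ (q : ℚ) + m := by
      have : min q (N - k) + m ≤ q + m := by omega
      exact_mod_cast this
    have c1 : ¬ (k = q + 1 ∧ m = 2 ∧ 2 * q + 1 ≤ N) := fun h => hne h.2.1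
    have c2 : ¬ (k = q + 2 ∧ m = 2 ∧ 2 * q + 1 ≤ N) := fun h => hne h.2.1
    rw [if_neg c1, if_neg c2, add_zero]
    have key : (P + 1 - m) * ((q : ℚ) + 1) ≤ 0 * ((q : ℚ) + 1) := by rw [zero_mul]; nlinarith
    have key' : P + 1 - m ≤ 0 := le_of_mul_le_mul_right key hpos
    split_ifs <;> linarith
  · -- m = 2
    have hm2 : m = 2 := by exact_mod_cast hm2q
    rcases Nat.lt_or_ge (q + 2) k with hk3 | hk2
    · -- k ≥ q + 3
      have hb : ((min q (N - k) + m : ℕ) : ℚ) ≤ (q : ℚ) + 2 := by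
        have : min q (N - k) + m ≤ q + 2 := by omega
        exact_mod_cast this
      have hne1 : ¬ k = q + 1 := by omega
      have hne2 : ¬ k = q + 2 := by omega
      have c1 : ¬ (k = q + 1 ∧ m = 2 ∧ 2 * q + 1 ≤ N) := fun h => hne1 h.1
      have c2 : ¬ (k = q + 2 ∧ m = 2 ∧ 2 * q + 1 ≤ N) := fun h => hne2 h.1
      rw [if_neg hne1, if_neg c1, if_neg c2, add_zero, add_zero]
      have key : (P - 2) * ((q : ℚ) + 1) ≤ 0 * ((q : ℚ) + 1) := by rw [zero_mul]; nlinarith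
      have key' : P - 2 ≤ 0 := le_of_mul_le_mul_right key hpos
      linarith
    · rcases Nat.lt_or_ge (q + 1) k with hk2' | hk1
      · -- k = q + 2
        have hkq2 : k = q + 2 := by omega
        have hb : ((min q (N - k) + m : ℕ) : ℚ) ≤ (q : ℚ) + 2 := by
          have : min q (N - k) + m ≤ q + 2 := by omega
          exact_mod_cast this
        have hne1 : ¬ k = q + 1 := by omega
        have c1 : ¬ (k = q + 1 ∧ m = 2 ∧ 2 * q + 1 ≤ N) := fun h => hne1 h.1
        rw [if_neg hne1, if_neg c1, add_zero, zero_add]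
        have key : (P - 2) * ((q : ℚ) + 1) ≤ -(q : ℚ) := by nlinarith
        by_cases hN2 : 2 * q + 1 ≤ N
        · have c2 : k = q + 2 ∧ m = 2 ∧ 2 * q + 1 ≤ N := ⟨hkq2, hm2, hN2⟩
          rw [if_pos c2, le_div_iff₀ hpos, hm2q]
          linarith
        · have c2 : ¬ (k = q + 2 ∧ m = 2 ∧ 2 * q + 1 ≤ N) := fun h => hN2 h.2.2
          rw [if_neg c2]
          have key2 : (P - 2) * ((q : ℚ) + 1) ≤ 0 * ((q : ℚ) + 1) := by rw [zero_mul]; linarith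
          have key' : P - 2 ≤ 0 := le_of_mul_le_mul_right key2 hpos
          linarith
      · -- k = q + 1
        have hkq1 : k = q + 1 := by omega
        have hne2 : ¬ k = q + 2 := by omega
        have c2 : ¬ (k = q + 2 ∧ m = 2 ∧ 2 * q + 1 ≤ N) := fun h => hne2 h.1
        rw [if_pos hkq1, if_neg c2, add_zero]
        by_cases hN2 : 2 * q + 1 ≤ N
        · have c1 : k = q + 1 ∧ m = 2 ∧ 2 * q + 1 ≤ N := ⟨hkq1, hm2, hN2⟩
          rw [if_pos c1]
          have hb : ((min q (N - k) + m : ℕ) : ℚ) ≤ (q : ℚ) + 2 := by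
            have : min q (N - k) + m ≤ q + 2 := by omega
            exact_mod_cast this
          rw [le_div_iff₀ hpos]
          nlinarith
        · have c1 : ¬ (k = q + 1 ∧ m = 2 ∧ 2 * q + 1 ≤ N) := fun h => hN2 h.2.2
          rw [if_neg c1]
          have hN2' : N ≤ 2 * q := by omega
          have hb : ((min q (N - k) + m : ℕ) : ℚ) ≤ (q : ℚ) + 1 := by
            have : min q (N - k) + m ≤ q + 1 := by omega
            exact_mod_cast this
          have key : (P + 1 - 2) * ((q : ℚ) + 1) ≤ 0 * ((q : ℚ) + 1) := by rw [zero_mul]; nlinarith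
          have key' : P + 1 - 2 ≤ 0 := le_of_mul_le_mul_right key hpos
          linarith

/-- The `(q+2)`-supersets of a `(q+1)`-subset `C` of a rank-`q` flat inside the flat: `C ∪ {z}`, `z ∈ F_C ∖ C`, are
rank-`q` sets with the same closure, hence the same `N` and `m`. -/
theorem insert_mem_of_mem_closureF {q : ℕ} {C : Finset α} (hC : C ∈ Profile.Rq M q) {z : α}
    (hz : z ∈ (gr M).filter (fun x => x ∈ M.closure (C : Set α)) \ C) :
    insert z C ∈ Profile.Rq M q ∧
      (gr M).filter (fun x => x ∈ M.closure ((insert z C : Finset α) : Set α)) =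
        (gr M).filter (fun x => x ∈ M.closure (C : Set α)) ∧
      (gr M).filter (fun x => x ∉ M.closure ((insert z C : Finset α) : Set α)) =
        (gr M).filter (fun x => x ∉ M.closure (C : Set α)) := by
  rw [Finset.mem_sdiff, Finset.mem_filter] at hz
  obtain ⟨hCg, hCr⟩ := Profile.mem_Rq.1 hC
  have hCE : (C : Set α) ⊆ M.E := by rw [← coe_gr]; exact_mod_cast hCg
  have hcl : M.closure ((insert z C : Finset α) : Set α) = M.closure (C : Set α) := by
    rw [Finset.coe_insert]
    exact Matroid.closure_insert_eq_of_mem_closure hz.1.2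
  refine ⟨?_, by rw [hcl], by rw [hcl]⟩
  rw [Profile.mem_Rq]
  refine ⟨Finset.insert_subset hz.1.1 hCg, ?_⟩
  rw [← Staged.coe_rkN, ThinGirth.rkN_insert_eq_of_mem_closure hCE hz.1.2, Staged.coe_rkN, hCr]

/-- **The double count**: among the rank-`q` sets with `≥ q + 1` points, those with `q + 1` points, `m = 2` and
`N ≥ 2q + 1` (the overloaded ones, family `A`) are at most `q` times those with `q + 2` points, `m = 2`, `N ≥ 2q + 1`
(family `B`): every member of `A` has `N − q − 1 ≥ q` supersets in `B` inside its flat, every member of `B` has at most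
`q + 2 ≤ q²` subsets in `A`. -/
theorem card_cond_le_mul_card_cond' {q : ℕ} (hq : 2 ≤ q) (Rb : Finset (Finset α))
    (hRb : ∀ B ∈ Rb, B ∈ Profile.Rq M q ∧ q + 1 ≤ B.card)
    (hRb' : ∀ B ∈ Profile.Rq M q, q + 1 ≤ B.card → B ∈ Rb) :
    (Rb.filter (fun B : Finset α => B.card = q + 1 ∧
        ((gr M).filter (fun x => x ∉ M.closure (B : Set α))).card = 2 ∧
        2 * q + 1 ≤ ((gr M).filter (fun x => x ∈ M.closure (B : Set α))).card)).card ≤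
      q * (Rb.filter (fun B : Finset α => B.card = q + 2 ∧
        ((gr M).filter (fun x => x ∉ M.closure (B : Set α))).card = 2 ∧
        2 * q + 1 ≤ ((gr M).filter (fun x => x ∈ M.closure (B : Set α))).card)).card := by
  set A := Rb.filter (fun B : Finset α => B.card = q + 1 ∧
      ((gr M).filter (fun x => x ∉ M.closure (B : Set α))).card = 2 ∧
      2 * q + 1 ≤ ((gr M).filter (fun x => x ∈ M.closure (B : Set α))).card) with hA
  set Bf := Rb.filter (fun B : Finset α => B.card = q + 2 ∧
      ((gr M).filter (fun x => x ∉ M.closure (B : Set α))).card = 2 ∧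
      2 * q + 1 ≤ ((gr M).filter (fun x => x ∈ M.closure (B : Set α))).card) with hBf
  -- the pairs
  set P := (A ×ˢ Bf).filter (fun p : Finset α × Finset α => p.1 ⊆ p.2) with hP
  have hP1 : P.card = ∑ C ∈ A, (Bf.filter (fun X => C ⊆ X)).card := by
    rw [hP, Finset.card_filter, Finset.sum_product]
    apply Finset.sum_congr rfl
    intro C _
    rw [Finset.card_filter]
  have hP2 : P.card = ∑ X ∈ Bf, (A.filter (fun C => C ⊆ X)).card := by
    rw [hP, Finset.card_filter, Finset.sum_product_right]
    apply Finset.sum_congr rfl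
    intro X _
    rw [Finset.card_filter]
  -- lower bound: every C ∈ A has ≥ q supersets in Bf
  have hlow : ∀ C ∈ A, q ≤ (Bf.filter (fun X => C ⊆ X)).card := by
    intro C hC
    rw [hA, Finset.mem_filter] at hC
    obtain ⟨hCRb, hCc, hCm, hCN⟩ := hC
    obtain ⟨hCq, _⟩ := hRb C hCRb
    set F := (gr M).filter (fun x => x ∈ M.closure (C : Set α)) with hF
    have hCF : C ⊆ F := by
      intro x hx
      rw [hF, Finset.mem_filter]
      have hCE : (C : Set α) ⊆ M.E := by rw [← coe_gr]; exact_mod_cast (Profile.mem_Rq.1 hCq).1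
      exact ⟨(Profile.mem_Rq.1 hCq).1 hx, M.subset_closure (C : Set α) hCE (Finset.mem_coe.2 hx)⟩
    have hFC : (F \ C).card = F.card - C.card := Finset.card_sdiff_of_subset hCF
    have himg : (F \ C).image (fun z => insert z C) ⊆ Bf.filter (fun X => C ⊆ X) := by
      rw [Finset.image_subset_iff]
      intro z hz
      obtain ⟨hXq, hXF, hXO⟩ := insert_mem_of_mem_closureF hCq hz
      have hzC : z ∉ C := (Finset.mem_sdiff.1 hz).2
      rw [Finset.mem_filter, hBf, Finset.mem_filter]
      refine ⟨⟨hRb' _ hXq (by rw [Finset.card_insert_of_notMem hzC]; omega), ?_, ?_, ?_⟩,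
        Finset.subset_insert z C⟩
      · rw [Finset.card_insert_of_notMem hzC, hCc]
      · rw [hXO]; exact hCm
      · rw [hXF]; exact hCN
    have hinj : Set.InjOn (fun z => insert z C) ((F \ C : Finset α) : Set α) := by
      intro z hz z' hz' hzz'
      simp only at hzz'
      have hzC : z ∉ C := (Finset.mem_sdiff.1 (Finset.mem_coe.1 hz)).2
      have hmem : z ∈ insert z' C := hzz' ▸ Finset.mem_insert_self z C
      rcases Finset.mem_insert.1 hmem with h | h
      · exact h
      · exact absurd h hzC
    calc q ≤ F.card - C.card := by omega
      _ = (F \ C).card := hFC.symm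
      _ = ((F \ C).image (fun z => insert z C)).card := (Finset.card_image_of_injOn hinj).symm
      _ ≤ (Bf.filter (fun X => C ⊆ X)).card := Finset.card_le_card himg
  -- upper bound: every X ∈ Bf has ≤ q + 2 subsets in A
  have hupp : ∀ X ∈ Bf, (A.filter (fun C => C ⊆ X)).card ≤ q + 2 := by
    intro X hX
    rw [hBf, Finset.mem_filter] at hX
    have hsub : A.filter (fun C => C ⊆ X) ⊆ Finset.powersetCard (q + 1) X := by
      intro C hC
      rw [Finset.mem_filter, hA, Finset.mem_filter] at hC
      rw [Finset.mem_powersetCard]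
      exact ⟨hC.2, hC.1.2.1⟩
    calc (A.filter (fun C => C ⊆ X)).card ≤ (Finset.powersetCard (q + 1) X).card := Finset.card_le_card hsub
      _ = Nat.choose X.card (q + 1) := Finset.card_powersetCard _ _
      _ = Nat.choose (q + 2) (q + 1) := by rw [hX.2.1]
      _ = q + 2 := by rw [Nat.choose_succ_self_right]
  have h1 : q * A.card ≤ P.card := by
    rw [hP1, Finset.card_eq_sum_ones, Finset.mul_sum]
    apply Finset.sum_le_sum
    intro C hC
    rw [mul_one]
    exact hlow C hC
  have h2 : P.card ≤ (q + 2) * Bf.card := by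
    rw [hP2, Finset.card_eq_sum_ones, Finset.mul_sum]
    apply Finset.sum_le_sum
    intro X hX
    rw [mul_one]
    exact hupp X hX
  have h3 : (q + 2) * Bf.card ≤ q * (q * Bf.card) := by
    have : q + 2 ≤ q * q := by nlinarith
    calc (q + 2) * Bf.card ≤ (q * q) * Bf.card := Nat.mul_le_mul_right _ this
      _ = q * (q * Bf.card) := by ring
  have h4 : q * A.card ≤ q * (q * Bf.card) := (h1.trans h2).trans h3
  exact Nat.le_of_mul_le_mul_left h4 (by omega)

end GirthRows

end PercRepro
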